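import Summits.CriticalPhenomena.Ising3DConformalLimit.Theorems.GapForcesFarMerging.Negative.SoftFamilies

/-!
# `GapForcesFarMerging` is not soft, IV: bubble divergence and the verdicts

Part 4/4 — far merging of family B, family C versus A, bubble divergence of the explicit kernel, the
three packages, and the headline no-go
theorems: `gapForcesFarMerging_false_without_model` (GAP shape ⇏ far merging over the soft
package), `farMergingForcesGap_false_without_model` (nor conversely), `gapShape_not_determined_by_bulk`
(GAP is a lattice-distance-1 datum invisible to any scaling limit), and
`oneEndedGapForcesFarMerging_false_without_model` (the RP-un-pinched residual is not soft either).

Split (Theorems files are ≤ 400 lines) of the theorem content of the standing adversary's work file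
`Summits/CriticalPhenomena/Ising3DConformalLimit/Cruxes/GapForcesFarMerging/Disproof.lean`
(crux `stmt-CriticalPhenomena-4468`, route `EnergyNotSigmaSquared`), landed under
`Theorems/GapForcesFarMerging/Negative/` so that ideators, planners and provers can import it.

## References

* M. Aizenman, Comm. Math. Phys. 86 (1982) 1–48 [AizenmanCMP1982].
* M. Aizenman, H. Duminil-Copin, Ann. Math. 194 (2021), §3 eqs. (3.7), (3.11)–(3.12)
  [AizenmanDuminilCopinAnnals2021].
* J. L. Lebowitz, Comm. Math. Phys. 35 (1974) 87–92 [Lebowitz1974].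
* H. Duminil-Copin, R. Panis, arXiv:2404.05700, Thm 1.8 [DuminilCopinPanis2025LowerBounds].
-/

noncomputable section

namespace Summit.CriticalPhenomena.Ising3DConformalLimit.Theorems.GapForcesFarMerging.Negative

open Literature.Probability.LatticeModels
open Summit.CriticalPhenomena.Ising3DConformalLimit.Theses.EnergyNotSigmaSquared

/-- `S₀` along the `e₂` axis. [folklore] -/
theorem S₀_zsmul_e₂ (a b : ℤ) : S₀ (a • e₂) (b • e₂) = (1 + |(b : ℝ) - a|)⁻¹ := by
  unfold S₀ g
  rw [← sub_smul, norm_smul]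
  simp [norm_e₂, Int.norm_eq_abs]

/-- The collinear shape is injective. [folklore] -/
theorem xs_injective : Function.Injective xs := by
  intro i j h
  have h1 := congrFun h 1
  fin_cases i <;> fin_cases j <;> simp [xs] at h1 ⊢

/-- **Family B has far merging** along every dilation of the collinear shape, with `c = 1/9`. [folklore] -/
theorem farMergingShape_B : FarMergingShape S₀ FB := by
  refine ⟨1 / 9, by norm_num, xs, xs_injective, fun L₀ => ⟨L₀ + 1, Nat.le_succ _, ?_⟩⟩
  set L : ℕ := L₀ + 1 with hL
  set y : Fin 4 → Site 3 := fun i => (L : ℤ) • xs i with hy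
  change Fθ θB y - (S₀ (y 0) (y 1) * S₀ (y 2) (y 3) + S₀ (y 0) (y 2) * S₀ (y 1) (y 3)
      + S₀ (y 0) (y 3) * S₀ (y 1) (y 2)) ≤ -(1 / 9 * (S₀ (y 0) (y 1) * S₀ (y 2) (y 3)))
  rw [Fθ_sub_wick]
  have hL1 : (1 : ℝ) ≤ L := by rw [hL]; push_cast; linarith [(Nat.cast_nonneg L₀ : (0:ℝ) ≤ L₀)]
  have hsep : (L : ℝ) ≤ sep y := le_sep_smul xs_injective L
  have hθ : θB y = 1 / 2 := by
    unfold θB; rw [if_neg]; exact ne_of_gt (lt_of_lt_of_le (by linarith) hsep)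
  rw [hθ]
  have hy0 : y 0 = ((L : ℤ) * 0) • e₂ := by simp only [hy, xs, Matrix.cons_val_zero, smul_smul]
  have hy1 : y 1 = ((L : ℤ) * 1) • e₂ := by
    simp only [hy, xs, Matrix.cons_val_zero, Matrix.cons_val_one, smul_smul]
  have hy2 : y 2 = ((L : ℤ) * 2) • e₂ := by simp only [hy, xs, Matrix.cons_val, smul_smul]
  have hy3 : y 3 = ((L : ℤ) * 3) • e₂ := by simp only [hy, xs, Matrix.cons_val, smul_smul]
  have hL0 : (0 : ℝ) ≤ L := by linarith
  have v01 : S₀ (y 0) (y 1) = (1 + (L : ℝ))⁻¹ := by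
    rw [hy0, hy1, S₀_zsmul_e₂]; push_cast; rw [show (L : ℝ) * 1 - L * 0 = L by ring, abs_of_nonneg hL0]
  have v23 : S₀ (y 2) (y 3) = (1 + (L : ℝ))⁻¹ := by
    rw [hy2, hy3, S₀_zsmul_e₂]; push_cast; rw [show (L : ℝ) * 3 - L * 2 = L by ring, abs_of_nonneg hL0]
  have v02 : S₀ (y 0) (y 2) = (1 + 2 * (L : ℝ))⁻¹ := by
    rw [hy0, hy2, S₀_zsmul_e₂]; push_cast
    rw [show (L : ℝ) * 2 - L * 0 = 2 * L by ring, abs_of_nonneg (by linarith)]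
  have v13 : S₀ (y 1) (y 3) = (1 + 2 * (L : ℝ))⁻¹ := by
    rw [hy1, hy3, S₀_zsmul_e₂]; push_cast
    rw [show (L : ℝ) * 3 - L * 1 = 2 * L by ring, abs_of_nonneg (by linarith)]
  have v03 : S₀ (y 0) (y 3) = (1 + 3 * (L : ℝ))⁻¹ := by
    rw [hy0, hy3, S₀_zsmul_e₂]; push_cast
    rw [show (L : ℝ) * 3 - L * 0 = 3 * L by ring, abs_of_nonneg (by linarith)]
  have v12 : S₀ (y 1) (y 2) = (1 + (L : ℝ))⁻¹ := by
    rw [hy1, hy2, S₀_zsmul_e₂]; push_cast; rw [show (L : ℝ) * 2 - L * 1 = L by ring, abs_of_nonneg hL0]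
  have hpmin : ((1 + 3 * (L : ℝ))⁻¹) ^ 2 ≤ pmin S₀ y := by
    unfold pmin P₁ P₂ P₃
    rw [v01, v23, v02, v13, v03, v12]
    have a1 : (1 + 3 * (L : ℝ))⁻¹ ≤ (1 + (L : ℝ))⁻¹ := inv_anti₀ (by positivity) (by linarith)
    have a2 : (1 + 3 * (L : ℝ))⁻¹ ≤ (1 + 2 * (L : ℝ))⁻¹ := inv_anti₀ (by positivity) (by linarith)
    have a0 : 0 ≤ (1 + 3 * (L : ℝ))⁻¹ := by positivity
    refine le_min (le_min ?_ ?_) ?_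
    · rw [sq]; exact mul_le_mul a1 a1 a0 (by positivity)
    · rw [sq]; exact mul_le_mul a2 a2 a0 (by positivity)
    · rw [sq]; exact mul_le_mul le_rfl a1 a0 (by positivity)
  rw [v01, v23]
  have h9 : 1 / 9 * ((1 + (L : ℝ))⁻¹ * (1 + (L : ℝ))⁻¹) ≤ ((1 + 3 * (L : ℝ))⁻¹) ^ 2 := by
    rw [show 1 / 9 * ((1 + (L : ℝ))⁻¹ * (1 + (L : ℝ))⁻¹) = ((3 * (1 + (L : ℝ))) ^ 2)⁻¹ by
      field_simp; ring, inv_pow]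
    exact inv_anti₀ (by positivity) (by nlinarith)
  linarith

/-- `θ_C = θ_A` off the nearest-neighbour stratum. [folklore] -/
theorem θC_eq_θA_of_two_le {y : Fin 4 → Site 3} (hy : 2 ≤ sep y) : θC y = θA y := by
  unfold θC; rw [if_neg]; linarith

/-- **Families A and C agree on every quadruple whose points are pairwise at distance `≥ 2`** — in
particular on every dilation `L·x`, `L ≥ 2`, of every injective lattice shape, hence on everything a
pointwise scaling limit can see. [folklore] -/
theorem FC_eq_FA_of_two_le_sep {y : Fin 4 → Site 3} (hy : 2 ≤ sep y) : FC y = FA y := by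
  simp only [FC, FA, Fθ, θC_eq_θA_of_two_le hy]

/-- Families A and C agree on every dilation `L ≥ 2` of an injective shape. [folklore] -/
theorem FC_eq_FA_smul {x : Fin 4 → Site 3} (hx : Function.Injective x) {L : ℕ} (hL : 2 ≤ L) :
    FC (fun i => (L : ℤ) • x i) = FA (fun i => (L : ℤ) • x i) :=
  FC_eq_FA_of_two_le_sep ((show (2 : ℝ) ≤ L by exact_mod_cast hL).trans (le_sep_smul hx L))

/-- **Family C violates the GAP shape** (it is `θ = 1/2` on the nearest-neighbour stratum). [folklore] -/
theorem not_gapShape_C : ¬ GapShape S₀ T₀ FC :=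
  not_gapShape_of_half thetaHyp_C.nonneg fun n hn => by
    unfold θC
    rw [sep_adjacent_eq_one n (by omega), if_pos rfl]

/-- **Family C has no far merging** (same bulk as A). [folklore] -/
theorem not_farMergingShape_C : ¬ FarMergingShape S₀ FC :=
  not_farMergingShape_of_decay thetaHyp_C.nonneg fun y hy => by
    rw [θC_eq_θA_of_two_le hy]; unfold θA; rw [max_eq_right (by linarith)]

/-- `Σ_x g(x)² = ∞` on `ℤ³`: the kernel `1/(1+‖x‖)` has a (linearly) divergent bubble, as the
critical two-point function of `ℤ³` does (Duminil-Copin–Panis 2025, Thm 1.8). [cite: DuminilCopinPanis2025LowerBounds, Thm 1.8] -/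
theorem not_summable_S₀_sq : ¬ Summable (fun x : Site 3 => S₀ 0 x ^ 2) := by
  intro h
  -- restrict to the quadrant plane `(i, j, 0)`
  let ι : ℕ × ℕ → Site 3 := fun p => ![(p.1 : ℤ), (p.2 : ℤ), 0]
  have hι : Function.Injective ι := by
    intro p q hpq
    have h0 := congrFun hpq 0
    have h1 := congrFun hpq 1
    simp only [ι, Matrix.cons_val_zero, Matrix.cons_val_one, Nat.cast_inj] at h0 h1
    exact Prod.ext h0 h1
  have h2 : Summable ((fun x : Site 3 => S₀ 0 x ^ 2) ∘ ι) := h.comp_injective hι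
  have hle : ∀ p : ℕ × ℕ, (((1 : ℝ) + p.1 + p.2) ^ 2)⁻¹ ≤ ((fun x : Site 3 => S₀ 0 x ^ 2) ∘ ι) p := by
    intro p
    have hn : ‖ι p‖ ≤ (p.1 : ℝ) + p.2 := by
      refine (pi_norm_le_iff_of_nonneg (by positivity)).2 fun k => ?_
      fin_cases k <;> simp [ι]
      positivity
    simp only [Function.comp_apply, S₀_zero_left, g_eq, inv_pow]
    exact inv_anti₀ (by positivity) (by nlinarith [norm_nonneg (ι p)])
  have h3 : Summable (fun p : ℕ × ℕ => (((1 : ℝ) + p.1 + p.2) ^ 2)⁻¹) :=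
    Summable.of_nonneg_of_le (fun p => by positivity) hle h2
  -- the planar harmonic-type series diverges
  have h0 : ∀ p : ℕ × ℕ, 0 ≤ (((1 : ℝ) + p.1 + p.2) ^ 2)⁻¹ := fun p => by positivity
  obtain ⟨hrow, hsum⟩ := (summable_prod_of_nonneg h0).1 h3
  have hlow : ∀ i : ℕ, (4 * ((i : ℝ) + 1))⁻¹ ≤ ∑' j : ℕ, (((1 : ℝ) + i + j) ^ 2)⁻¹ := by
    intro i
    have h1 : ∑ j ∈ Finset.range (i + 1), (((1 : ℝ) + i + j) ^ 2)⁻¹ ≤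
        ∑' j : ℕ, (((1 : ℝ) + i + j) ^ 2)⁻¹ :=
      (hrow i).sum_le_tsum (Finset.range (i + 1)) fun j _ => by positivity
    refine le_trans ?_ h1
    have h2 : ∀ j ∈ Finset.range (i + 1), (((1 : ℝ) + 2 * i) ^ 2)⁻¹ ≤ (((1 : ℝ) + i + j) ^ 2)⁻¹ := by
      intro j hj
      have hj' : (j : ℝ) ≤ i := by exact_mod_cast Nat.lt_succ_iff.1 (Finset.mem_range.1 hj)
      apply inv_anti₀ (by positivity)
      apply pow_le_pow_left₀ (by positivity)
      linarith
    have h3 := Finset.card_nsmul_le_sum (Finset.range (i + 1)) _ _ h2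
    rw [Finset.card_range, nsmul_eq_mul] at h3
    refine le_trans ?_ h3
    push_cast
    rw [show (4 * ((i : ℝ) + 1))⁻¹ = ((i : ℝ) + 1) * ((2 * ((i : ℝ) + 1)) ^ 2)⁻¹ by
      field_simp; ring]
    apply mul_le_mul_of_nonneg_left _ (by positivity)
    apply inv_anti₀ (by positivity)
    apply pow_le_pow_left₀ (by positivity)
    linarith
  have h4 : Summable (fun i : ℕ => (4 * ((i : ℝ) + 1))⁻¹) :=
    Summable.of_nonneg_of_le (fun i => by positivity) hlow hsum
  have h5 : Summable (fun i : ℕ => ((i : ℝ) + 1)⁻¹) := by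
    refine (h4.mul_left 4).congr fun i => ?_
    field_simp
  refine Real.not_summable_natCast_inv ((summable_nat_add_iff (f := fun m : ℕ => (m : ℝ)⁻¹) 1).1 ?_)
  simpa using h5

/-- Family A has the soft package. [folklore] -/
theorem softPackage_A : SoftPackage S₀ T₀ FA := softPackage_Fθ_core thetaHyp_A not_summable_S₀_sq

/-- Family B has the soft package. [folklore] -/
theorem softPackage_B : SoftPackage S₀ T₀ FB := softPackage_Fθ_core thetaHyp_B not_summable_S₀_sq

/-- Family C has the soft package. [folklore] -/
theorem softPackage_C : SoftPackage S₀ T₀ FC := softPackage_Fθ_core thetaHyp_C not_summable_S₀_sq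

/-- **(a) Load-bearing analysis: the model is load-bearing.** Any proof of `GapForcesFarMerging`
must use a property of `criticalCorr 3` outside the soft package (translation + hyperoctahedral +
permutation symmetry, `σ² = 1`, GKS I/II, Lebowitz, Aizenman's `|U₄| ≤ 2⟨σσ⟩⟨σσ⟩`, the `ℤ³` two-point
bounds, Messager–Miracle-Solé, bubble divergence): family A has all of it and GAP with `κ = 1`, and
no far merging on any shape. [cite: AizenmanDuminilCopinAnnals2021, eq. (3.12)] -/
theorem gapForcesFarMerging_false_without_model :
    ¬ ∀ (S : Site 3 → Site 3 → ℝ) (T : Site 3 → ℝ) (F : (Fin 4 → Site 3) → ℝ),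
      SoftPackage S T F → GapShape S T F → FarMergingShape S F := fun h =>
  not_farMergingShape_A (h S₀ T₀ FA softPackage_A gapShape_A)

/-- **(c) The converse transfer is not soft either** (card A6's "uniform far merging ⇒ κ > 0" also
needs the model): family B has the package and far merging along every dilation of a fixed shape,
and violates the GAP shape for every `κ > 0`. [folklore] -/
theorem farMergingForcesGap_false_without_model :
    ¬ ∀ (S : Site 3 → Site 3 → ℝ) (T : Site 3 → ℝ) (F : (Fin 4 → Site 3) → ℝ),
      SoftPackage S T F → FarMergingShape S F → GapShape S T F := fun h =>
  not_gapShape_B (h S₀ T₀ FB softPackage_B farMergingShape_B)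

/-- **(c′) GAP is invisible in the bulk.** Two families with the full soft package that coincide on
every quadruple with pairwise distances `≥ 2` (so they have the same rescaled limits along every
dilation sequence, the same `U₄` on every far configuration, and neither has far merging), one with
the GAP shape and one without: the hypothesis of the crux is a lattice-distance-`1` datum that no
statement about pointwise scaling limits of the four-point function can encode. [folklore] -/
theorem gapShape_not_determined_by_bulk :
    ∃ (S : Site 3 → Site 3 → ℝ) (T : Site 3 → ℝ) (F F' : (Fin 4 → Site 3) → ℝ),
      SoftPackage S T F ∧ SoftPackage S T F' ∧ (∀ y, 2 ≤ sep y → F' y = F y) ∧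
        GapShape S T F ∧ ¬ GapShape S T F' ∧ ¬ FarMergingShape S F ∧ ¬ FarMergingShape S F' :=
  ⟨S₀, T₀, FA, FC, softPackage_A, softPackage_C, fun _ hy => FC_eq_FA_of_two_le_sep hy, gapShape_A,
    not_gapShape_C, not_farMergingShape_A, not_farMergingShape_C⟩

/-- `|g(v) - g(v - e₂)| ≤ g(v)·g(v - e₂)` (the sup norms differ by at most `1`). [folklore] -/
theorem abs_g_sub_g_le (v : Site 3) : |g v - g (v - e₂)| ≤ g v * g (v - e₂) := by
  have h1 : |‖v‖ - ‖v - e₂‖| ≤ 1 := by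
    have := abs_norm_sub_norm_le v (v - e₂)
    simpa [norm_e₂] using this
  have ha : 0 < 1 + ‖v‖ := by positivity
  have hb : 0 < 1 + ‖v - e₂‖ := by positivity
  rw [g_eq, g_eq, inv_sub_inv ha.ne' hb.ne', abs_div, abs_of_pos (mul_pos ha hb), ← mul_inv,
    div_eq_mul_inv]
  apply mul_le_of_le_one_left (by positivity)
  calc |1 + ‖v - e₂‖ - (1 + ‖v‖)| = |‖v‖ - ‖v - e₂‖| := by
        rw [show 1 + ‖v - e₂‖ - (1 + ‖v‖) = -(‖v‖ - ‖v - e₂‖) by ring, abs_neg]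
    _ ≤ 1 := h1

/-- `g(v - e₂) ≤ ‖v‖⁻¹` for `v ≠ 0`-sized vectors (`‖v - e₂‖ ≥ ‖v‖ - 1`). [folklore] -/
theorem g_sub_e₂_le {v : Site 3} (hv : 1 ≤ ‖v‖) : g (v - e₂) ≤ ‖v‖⁻¹ := by
  rw [g_eq]
  apply inv_anti₀ (by linarith)
  have := norm_sub_norm_le v e₂
  rw [norm_e₂] at this
  linarith

/-- **Family A has the one-ended gap shape** with exponent `1`, constant `1`, radius `4`: on
`(0, e₂, y, z)` its truncation is `|g(y)g(z-e₂) - g(z)g(y-e₂)| ≤ ‖y‖⁻¹·g(y)g(z-e₂) + ‖z‖⁻¹·g(z)g(y-e₂)`.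
[folklore] -/
theorem oneEndedGapShape_A : OneEndedGapShape S₀ FA := by
  refine ⟨1, 1, 4, one_pos, fun y z hy hz => ?_⟩
  set w : Fin 4 → Site 3 := ![0, e₂, y, z] with hw
  have hθ : θA w = 1 := by
    unfold θA
    have h := sep_le_norm w (i := 0) (j := 1) (by decide)
    have h1 : sep w ≤ 1 := by simpa [hw, norm_e₂] using h
    rw [max_eq_left h1]; simp
  -- the three pairing products
  have hP1 : P₁ S₀ w = g e₂ * g (z - y) := by simp [P₁, hw, S₀]
  have hP2 : P₂ S₀ w = g y * g (z - e₂) := by simp [P₂, hw, S₀]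
  have hP3 : P₃ S₀ w = g z * g (y - e₂) := by simp [P₃, hw, S₀]
  have hS1 : S₀ 0 e₂ * S₀ y z = g e₂ * g (z - y) := by simp [S₀]
  have hS2 : S₀ 0 y * S₀ e₂ z = g y * g (z - e₂) := by simp [S₀]
  have hS3 : S₀ 0 z * S₀ e₂ y = g z * g (y - e₂) := by simp [S₀]
  have hF : FA w - S₀ 0 e₂ * S₀ y z =
      P₂ S₀ w + P₃ S₀ w - 2 * min (min (P₁ S₀ w) (P₂ S₀ w)) (P₃ S₀ w) := by
    simp only [FA, Fθ, wick, pmin, hθ, mul_one, hS1, hP1]; ring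
  rw [hF, hS2, hS3, hP1, hP2, hP3, Real.rpow_neg_one]
  have hy1 : (1 : ℝ) ≤ ‖y‖ := by linarith
  have hz1 : (1 : ℝ) ≤ ‖z‖ := by linarith
  -- P₂ ≤ P₁ : g(y) g(z - e₂) ≤ g(e₂) g(z - y)
  have hze : 3 ≤ ‖z - e₂‖ := by
    have := norm_sub_norm_le z e₂; rw [norm_e₂] at this; linarith
  have hzy : ‖z - y‖ ≤ ‖z - e₂‖ + ‖y‖ + 1 := by
    calc ‖z - y‖ = ‖(z - e₂) + (e₂ - y)‖ := by rw [sub_add_sub_cancel]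
      _ ≤ ‖z - e₂‖ + ‖e₂ - y‖ := norm_add_le _ _
      _ ≤ ‖z - e₂‖ + (‖e₂‖ + ‖y‖) := by gcongr; exact norm_sub_le _ _
      _ = ‖z - e₂‖ + ‖y‖ + 1 := by rw [norm_e₂]; ring
  have hP21 : g y * g (z - e₂) ≤ g e₂ * g (z - y) := by
    rw [g_e₂, g_eq, g_eq, g_eq, ← mul_inv, one_div, ← mul_inv]
    apply inv_anti₀ (by positivity)
    nlinarith [mul_le_mul_of_nonneg_left hze (by linarith : (0:ℝ) ≤ ‖y‖ - 1)]
  rw [min_eq_right hP21]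
  -- |P₂ - P₃| bound
  have hdiff : g y * g (z - e₂) + g z * g (y - e₂) - 2 * min (g y * g (z - e₂)) (g z * g (y - e₂)) =
      |g y * g (z - e₂) - g z * g (y - e₂)| := by
    rcases le_total (g y * g (z - e₂)) (g z * g (y - e₂)) with h | h
    · rw [min_eq_left h, abs_of_nonpos (by linarith)]; ring
    · rw [min_eq_right h, abs_of_nonneg (by linarith)]; ring
  rw [hdiff]
  have hsplit : g y * g (z - e₂) - g z * g (y - e₂) =
      (g y - g (y - e₂)) * g (z - e₂) + g (y - e₂) * (g (z - e₂) - g z) := by ring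
  have h0 : ∀ v : Site 3, 0 ≤ g v := fun v => (g_pos v).le
  have hmin : 0 < min ‖y‖ ‖z‖ := by rw [lt_min_iff]; constructor <;> linarith
  calc |g y * g (z - e₂) - g z * g (y - e₂)|
      ≤ |g y - g (y - e₂)| * g (z - e₂) + g (y - e₂) * |g (z - e₂) - g z| := by
        rw [hsplit]
        refine (abs_add_le _ _).trans ?_
        rw [abs_mul, abs_mul, abs_of_nonneg (h0 (z - e₂)), abs_of_nonneg (h0 (y - e₂))]
    _ ≤ (g y * g (y - e₂)) * g (z - e₂) + g (y - e₂) * (g z * g (z - e₂)) := by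
        gcongr
        · exact h0 _
        · exact abs_g_sub_g_le y
        · exact h0 _
        · rw [abs_sub_comm]; exact abs_g_sub_g_le z
    _ = g (y - e₂) * (g y * g (z - e₂)) + g (z - e₂) * (g z * g (y - e₂)) := by ring
    _ ≤ ‖y‖⁻¹ * (g y * g (z - e₂)) + ‖z‖⁻¹ * (g z * g (y - e₂)) := by
        gcongr
        · exact mul_nonneg (h0 _) (h0 _)
        · exact g_sub_e₂_le hy1
        · exact mul_nonneg (h0 _) (h0 _)
        · exact g_sub_e₂_le hz1
    _ ≤ (min ‖y‖ ‖z‖)⁻¹ * (g y * g (z - e₂)) + (min ‖y‖ ‖z‖)⁻¹ * (g z * g (y - e₂)) := by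
        gcongr
        · exact mul_nonneg (h0 _) (h0 _)
        · exact min_le_left _ _
        · exact mul_nonneg (h0 _) (h0 _)
        · exact min_le_right _ _
    _ = 1 * (min ‖y‖ ‖z‖)⁻¹ * (g y * g (z - e₂) + g z * g (y - e₂)) := by ring

/-- **The un-pinched residual crux is not soft either**: "one-ended gap ⇒ far merging" (card
`rp-unpinch-single-passage`'s `C⁺ = SinglePinchForcesFarMerging`, card `rp-gram-halving`'s
`OneEndedGap`-transfer) fails for family A, which has the soft package, the one-ended gap for ALL far
target pairs with exponent `1`, and no far merging. [folklore] -/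
theorem oneEndedGapForcesFarMerging_false_without_model :
    ¬ ∀ (S : Site 3 → Site 3 → ℝ) (T : Site 3 → ℝ) (F : (Fin 4 → Site 3) → ℝ),
      SoftPackage S T F → OneEndedGapShape S F → FarMergingShape S F := fun h =>
  not_farMergingShape_A (h S₀ T₀ FA softPackage_A oneEndedGapShape_A)

end Summit.CriticalPhenomena.Ising3DConformalLimit.Theorems.GapForcesFarMerging.Negative

end
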